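import Literature.Analysis.ODE.AutonomousContinuation
import Mathlib.Analysis.Calculus.ContDiff.RCLike
import Mathlib.Analysis.Calculus.MeanValue
import Mathlib.Topology.MetricSpace.Thickening
import HarnessLib

/-!
# Autonomous ODEs confined to a compact set: global existence, Lipschitz bounds

Topic `Literature/Analysis/ODE`. Two complements to the continuation theory of
`AutonomousContinuation.lean` / `GlobalExistence.lean` for the autonomous equation `X' = F(X)`
with `F` of class `C¹` on an open set `O` of a finite-dimensional (more generally proper) real
normed space, written for solutions in the derivative-within convention of those files
(`∀ t ∈ Icc a b, HasDerivWithinAt X (F (X t)) (Icc a b) t`):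

* `exists_uniform_lipschitz_of_isCompact` — **uniform local data along a compact set**: for
  `K ⊆ O` compact there are `r > 0` and constants `C, B` such that around every point of `K` the
  closed `r`-ball lies in `O`, `F` is `C`-Lipschitz on it and bounded by `B` (a closed thickening
  of `K` inside `O` is compact; mean value inequality on the convex balls);
* `exists_lipschitzOnWith_of_isCompact` — `F` is Lipschitz on `K` itself (pairs of points closer
  than `r` by the previous item, distant pairs by boundedness);
* `exists_solution_Icc_extend_by` — the restart lemma of `AutonomousContinuation.lean` with the
  explicit gain of time `r / (B + 1)`;
* `exists_solution_of_confined` — **global existence under a priori confinement** (Teschl,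
  *Ordinary Differential Equations and Dynamical Systems* (2012), Cor. 2.15–2.16: a solution whose
  orbit remains in a compact subset of the domain exists for all positive times; here on a
  prescribed horizon `[0, T]`): if every solution from `x₀` on any `[0, s] ⊆ [0, T]` takes values
  in the compact `K ⊆ O`, then there is a solution on `[0, T]` — by finitely many restarts of
  uniform length.

Everything is proved; there are no definitions and no named facts.

## References

* G. Teschl, *Ordinary Differential Equations and Dynamical Systems*, GSM 140, AMS 2012, §2.4
  (Thm. 2.13, extensibility) and §2.6, Cor. 2.15–2.16. [Teschl2012]
* A. J. Majda, A. L. Bertozzi, *Vorticity and Incompressible Flow*, CUP 2002, §4.2 Thm. 4.4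
  (continuation of an autonomous ODE), as formalised in `AutonomousContinuation.lean`.
  [MajdaBertozziCUP2002]
-/

noncomputable section

open Set Metric Filter Topology Function
open scoped NNReal

namespace Literature.Analysis.ODE

variable {E : Type*} [NormedAddCommGroup E] [NormedSpace ℝ E]

/-! ### Uniform Lipschitz data along a compact subset of the domain -/

/-- **Uniform local data along a compact set.** Let `F` be `C¹` on an open set `O` of a proper
real normed space and `K ⊆ O` compact. Then there are `r > 0` and `C B : ℝ≥0` such that for every
`x ∈ K` the closed ball `closedBall x r` lies in `O`, `F` is `C`-Lipschitz on it and `‖F‖ ≤ B`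
there: a closed `r`-thickening of `K` is a compact subset of `O`
(`IsCompact.exists_cthickening_subset_open`), on which `F` and `DF` are bounded, and the mean
value inequality applies on each (convex) ball. (Teschl 2012, proof of Thm. 2.13 / Cor. 2.15: the
local Lipschitz data is uniform on compact sets.) [cite: Teschl2012, Thm. 2.13 (proof)] -/
theorem exists_uniform_lipschitz_of_isCompact [ProperSpace E] {F : E → E} {O K : Set E}
    (hO : IsOpen O) (hF : ContDiffOn ℝ 1 F O) (hK : IsCompact K) (hKO : K ⊆ O) :
    ∃ r : ℝ≥0, 0 < r ∧ ∃ C B : ℝ≥0, ∀ x ∈ K, closedBall x r ⊆ O ∧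
      LipschitzOnWith C F (closedBall x r) ∧ ∀ y ∈ closedBall x r, ‖F y‖ ≤ B := by
  obtain ⟨r, hr, hrO⟩ := hK.exists_cthickening_subset_open hO hKO
  set K' : Set E := cthickening r K with hK'
  have hK'c : IsCompact K' := hK.cthickening
  have hdiff : ∀ y ∈ O, DifferentiableAt ℝ F y := fun y hy ↦
    (hF.differentiableOn one_ne_zero y hy).differentiableAt (hO.mem_nhds hy)
  have hcontDF : ContinuousOn (fderiv ℝ F) K' :=
    (hF.continuousOn_fderiv_of_isOpen hO le_rfl).mono hrO
  have hcontF : ContinuousOn F K' := hF.continuousOn.mono hrO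
  obtain ⟨C₀, hC₀⟩ := hK'c.exists_bound_of_continuousOn hcontDF
  obtain ⟨B₀, hB₀⟩ := hK'c.exists_bound_of_continuousOn hcontF
  refine ⟨⟨r, hr.le⟩, by exact_mod_cast hr, ⟨max C₀ 0, le_max_right _ _⟩,
    ⟨max B₀ 0, le_max_right _ _⟩, fun x hx ↦ ?_⟩
  have hball : closedBall x r ⊆ K' := closedBall_subset_cthickening hx r
  refine ⟨hball.trans hrO, ?_, fun y hy ↦ (hB₀ y (hball hy)).trans (le_max_left _ _)⟩
  refine (convex_closedBall x r).lipschitzOnWith_of_nnnorm_fderiv_le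
    (fun y hy ↦ hdiff y (hrO (hball hy))) fun y hy ↦ ?_
  have h := (hC₀ y (hball hy)).trans (le_max_left C₀ 0)
  exact_mod_cast h

/-- **A `C¹` field is Lipschitz on every compact subset of its (open) domain**: pairs of points at
distance `< r` lie in a common ball of `exists_uniform_lipschitz_of_isCompact`, pairs at distance
`≥ r` are handled by the bound `‖F‖ ≤ B` (`dist (F y) (F z) ≤ 2B ≤ (2B/r) dist y z`).
[cite: Teschl2012, Thm. 2.13 (proof)] -/
theorem exists_lipschitzOnWith_of_isCompact [ProperSpace E] {F : E → E} {O K : Set E}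
    (hO : IsOpen O) (hF : ContDiffOn ℝ 1 F O) (hK : IsCompact K) (hKO : K ⊆ O) :
    ∃ C : ℝ≥0, LipschitzOnWith C F K := by
  obtain ⟨r, hr, C, B, h⟩ := exists_uniform_lipschitz_of_isCompact hO hF hK hKO
  have hr' : (0 : ℝ) < r := by exact_mod_cast hr
  set C' : ℝ≥0 := C + 2 * B / r with hC'
  refine ⟨C', LipschitzOnWith.of_dist_le_mul fun y hy z hz ↦ ?_⟩
  by_cases hyz : dist y z < r
  · -- both points lie in the closed `r`-ball around `y`
    obtain ⟨-, hlip, -⟩ := h y hy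
    have h1 := hlip.dist_le_mul y (mem_closedBall_self hr'.le) z
      (mem_closedBall.2 (by rw [dist_comm]; exact hyz.le))
    refine h1.trans ?_
    gcongr
    rw [hC']
    exact_mod_cast le_self_add
  · -- distant points: use the bound on `F`
    rw [not_lt] at hyz
    obtain ⟨-, -, hby⟩ := h y hy
    obtain ⟨-, -, hbz⟩ := h z hz
    have hFy := hby y (mem_closedBall_self hr'.le)
    have hFz := hbz z (mem_closedBall_self hr'.le)
    have h2 : dist (F y) (F z) ≤ 2 * B := by
      rw [dist_eq_norm]
      calc ‖F y - F z‖ ≤ ‖F y‖ + ‖F z‖ := norm_sub_le _ _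
        _ ≤ B + B := add_le_add hFy hFz
        _ = 2 * B := by ring
    have h3 : (2 * B : ℝ) ≤ (2 * B / r) * dist y z := by
      rw [div_mul_eq_mul_div, le_div_iff₀ hr']
      exact mul_le_mul_of_nonneg_left hyz (by positivity)
    refine h2.trans (h3.trans ?_)
    gcongr
    rw [hC']
    push_cast
    exact le_add_of_nonneg_left C.coe_nonneg

/-! ### Restart with an explicit gain of time -/

/-- **Restart, quantitative form.** A solution of `X' = F(X)` on `[a, b]` is continued to
`[a, b + r/(B+1)]` when `F` is `C`-Lipschitz and bounded by `B` on the closed ball of radius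
`r > 0` around `X b` (Picard–Lindelöf on `[b, b + r/(B+1)]`, Mathlib's
`IsPicardLindelof.of_time_independent`, glued by `solution_append`; the statement of the tree's
`exists_solution_Icc_extend` with its gain of time made explicit). [folklore] -/
theorem exists_solution_Icc_extend_by [CompleteSpace E] {F : E → E} {Y : ℝ → E} {a b : ℝ}
    (hab : a ≤ b) (hY : ∀ t ∈ Icc a b, HasDerivWithinAt Y (F (Y t)) (Icc a b) t)
    {r : ℝ≥0} (hr : 0 < r) {C B : ℝ≥0} (hlip : LipschitzOnWith C F (closedBall (Y b) r))
    (hbd : ∀ y ∈ closedBall (Y b) r, ‖F y‖ ≤ B) :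
    ∃ Z : ℝ → E, (∀ t ∈ Icc a (b + r / (B + 1)),
      HasDerivWithinAt Z (F (Z t)) (Icc a (b + r / (B + 1))) t) ∧ EqOn Z Y (Icc a b) := by
  set δ : ℝ := (r : ℝ) / ((B : ℝ) + 1) with hδ
  have hB1 : (0 : ℝ) < (B : ℝ) + 1 := by positivity
  have hδpos : 0 < δ := by rw [hδ]; positivity
  set b' : ℝ := b + δ with hb'
  have hbb' : b ≤ b' := by rw [hb']; linarith
  set T₀ : Icc b b' := ⟨b, left_mem_Icc.2 hbb'⟩ with hT₀
  have hPL : IsPicardLindelof (fun _ : ℝ ↦ F) T₀ (Y b) r 0 B C := by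
    refine IsPicardLindelof.of_time_independent hbd hlip ?_
    have h1 : max (b' - (T₀ : ℝ)) ((T₀ : ℝ) - b) = δ := by
      rw [hT₀]
      simp only [sub_self]
      rw [hb', add_sub_cancel_left, max_eq_left hδpos.le]
    rw [h1, NNReal.coe_zero, sub_zero]
    rw [hδ, mul_div_assoc', div_le_iff₀ hB1]
    nlinarith [B.coe_nonneg, r.coe_nonneg]
  obtain ⟨β, hβ0, hβ⟩ := hPL.exists_eq_forall_mem_Icc_hasDerivWithinAt (mem_closedBall_self le_rfl)
  exact ⟨fun t ↦ if t ≤ b then Y t else β t,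
    solution_append (v := fun _ ↦ F) hY hβ hab hbb' hβ0.symm, append_eqOn_left Y β a b⟩

/-! ### Global existence under a priori confinement to a compact set -/

/-- **Global existence under a priori confinement** (Teschl 2012, Cor. 2.15: "if a solution
remains in a compact subset of the domain its maximal interval of existence is all of `ℝ`",
forward and on a prescribed horizon). Let `F` be `C¹` on an open set `O` of a proper complete real
normed space, `K ⊆ O` compact, `T ≥ 0`, and suppose that every solution `X` of
`X' = F(X)` with `X 0 = x₀` on any `[0, s]`, `s ≤ T`, takes its values in `K`. Then there is a
solution on `[0, T]` starting at `x₀`. Proof: with the uniform data `(r, C, B)` of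
`exists_uniform_lipschitz_of_isCompact` every solution on `[0, s]` ending in `K` restarts to
`[0, s + r/(B+1)]` (`exists_solution_Icc_extend_by`); induction on the number of steps.
[cite: Teschl2012, Cor. 2.15] -/
theorem exists_solution_of_confined [ProperSpace E] [CompleteSpace E] {F : E → E} {O K : Set E}
    (hO : IsOpen O) (hF : ContDiffOn ℝ 1 F O) (hK : IsCompact K) (hKO : K ⊆ O) {x₀ : E}
    {T : ℝ} (hT : 0 ≤ T)
    (hconf : ∀ s ∈ Icc 0 T, ∀ X : ℝ → E, X 0 = x₀ →
      (∀ t ∈ Icc 0 s, HasDerivWithinAt X (F (X t)) (Icc 0 s) t) → ∀ t ∈ Icc 0 s, X t ∈ K) :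
    ∃ X : ℝ → E, X 0 = x₀ ∧ ∀ t ∈ Icc 0 T, HasDerivWithinAt X (F (X t)) (Icc 0 T) t := by
  obtain ⟨r, hr, C, B, hdata⟩ := exists_uniform_lipschitz_of_isCompact hO hF hK hKO
  set δ : ℝ := r / (B + 1) with hδ
  have hδpos : 0 < δ := by rw [hδ]; positivity
  -- after `k` restarts: a solution on `[0, min (k δ) T]`
  have step : ∀ k : ℕ, ∃ X : ℝ → E, X 0 = x₀ ∧
      ∀ t ∈ Icc 0 (min (k * δ) T), HasDerivWithinAt X (F (X t)) (Icc 0 (min (k * δ) T)) t := by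
    intro k
    induction k with
    | zero =>
      refine ⟨fun _ ↦ x₀, rfl, ?_⟩
      have h0 : min ((0 : ℕ) * δ) T = 0 := by
        rw [Nat.cast_zero, zero_mul, min_eq_left hT]
      rw [h0]
      exact solution_const (fun _ ↦ F) 0 x₀
    | succ k ih =>
      obtain ⟨X, hX0, hX⟩ := ih
      set s : ℝ := min (k * δ) T with hs
      have hs0 : 0 ≤ s := le_min (by positivity) hT
      have hsT : s ≤ T := min_le_right _ _
      -- the endpoint lies in `K`, so the solution restarts
      have hXs : X s ∈ K := hconf s ⟨hs0, hsT⟩ X hX0 hX s ⟨hs0, le_rfl⟩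
      obtain ⟨hballO, hlip, hbd⟩ := hdata (X s) hXs
      obtain ⟨Z, hZ, hZX⟩ := exists_solution_Icc_extend_by (F := F) hs0 hX hr hlip hbd
      have hZ0 : Z 0 = x₀ := by rw [hZX (left_mem_Icc.2 hs0), hX0]
      refine ⟨Z, hZ0, solution_mono hZ le_rfl ?_⟩
      -- `min ((k+1) δ) T ≤ s + δ`
      have h1 : min (((k + 1 : ℕ) : ℝ) * δ) T ≤ s + δ := by
        rw [hs]
        rcases le_total ((k : ℝ) * δ) T with hle | hle
        · rw [min_eq_left hle]
          refine (min_le_left _ _).trans ?_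
          push_cast
          linarith
        · rw [min_eq_right hle]
          exact (min_le_right _ _).trans (by linarith)
      exact h1
  -- enough steps to reach `T`
  obtain ⟨k, hk⟩ : ∃ k : ℕ, T / δ ≤ k := exists_nat_ge _
  have hkT : min ((k : ℝ) * δ) T = T := by
    refine min_eq_right ?_
    rwa [div_le_iff₀ hδpos] at hk
  obtain ⟨X, hX0, hX⟩ := step k
  rw [hkT] at hX
  exact ⟨X, hX0, hX⟩

end Literature.Analysis.ODE

end
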